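import Mathlib
import Summits.ValiantsHypothesis.ValiantsHypothesis.Theorems.BarrierLeverPartitionMinorsHitByVPHiddenStatesCutGameLinkBound
import Summits.ValiantsHypothesis.ValiantsHypothesis.Theorems.BarrierLeverPartitionMinorsHitByVPSimplexJoinBoxGame

/-!
# Route BarrierLever — item `PartitionMinorsHitByVP` (stmt-ValiantsHypothesis-19717), line `hidden_states`:
# THE BOX GAME WITH THE LAYER-CAKE DEMAND FLOOR — the composition the winning invariant actually needs

Helper file (`--supports stmt-ValiantsHypothesis-19717`; cell valiant-natproofs, rung V4, 𝒟-side door (c), line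
`Cruxes/PartitionMinorsHitByVP/Lines/hidden_states.lean` v8, registered stub `stub_simplexPairLower` ≡ `SimplexJoin.Stmt.simplexPairLower`;
prover seat val-np-p3 gen 14). Definition-free. Closes NO item.

THE POINT (memo val-np-p3 g14 «box game census», evidence on 19717). p647518 (`simplexPairLower_of_boxWinning`) lets a box-game
winning predicate `W` assume only the CRUDE demand floor `⌊(r−2)/hd⌋ + 1 ≤ r₁` (pigeonhole link bound). The g14 census of the exact
game shows why that floor is the wrong interface for a ∀h invariant: at volume `r ≈ 2^(hd−1)` the crude floor lets the adversary demand
`r/hd`, and iterating «minimum demand, follow the small child» divides the volume by `≈ hd` per round while a budget box can shed at most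
one dimension per round — the ball radius `t(hd, r)` (least `t` with `Σ_{j≤t} C(hd,j) ≥ r`) then falls below the dimension of every
top-level box within `O(h / log h)` rounds, which the exact census identifies as a losing configuration (a `d`-dimensional box needs
`r > Σ_{j<d} C(hd, j)`). With the SHARP floor of p648639 (`exists_link_ge_layerCake`: some coordinate has link
`≥ ⌈S(hd, r)/hd⌉`, `S(hd,r) = Σ_{d<hd} (r − Σ_{j≤d} C(hd,j))⁺`) the minimum-demand chain is the ball chain
`B_t([hd]) → B_{t−1}([hd−1])`: the radius drops by exactly one per round. This file is p647518 verbatim with that floor: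
`simplexSymGood_of_boxWinning_layerCake`, `exists_simplexTable_of_boxWinning_layerCake`, and the two node arrows
`simplexPairLower_of_boxWinning_layerCake` (registered `Stmt.simplexPairLower` by name; hypothesis inlined, definition-free) and
`partitionMinorsHitByVP_of_boxWinning_layerCake` (the item, `b = 14`). A winning predicate for the crude floor is one for the sharp
floor (`boxWinning_layerCake_of_crude`), so nothing is lost.

WHAT THIS IS NOT: no winning predicate is constructed here; `Stmt.simplexPairLower` and item 19717 stay OPEN; nothing on crux 14610 or VP ≠ VNP.
-/

set_option linter.dupNamespace false

namespace Summit.ValiantsHypothesis.ValiantsHypothesis.Theorems.BarrierLever.SimplexJoin.Cut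

open Finset Matrix MvPolynomial
open Summit.ValiantsHypothesis.ValiantsHypothesis.Theorems.BarrierLever.HiddenStates

noncomputable section

variable {h m D N : ℕ}

/-- The crude floor never exceeds the sharp one's obligations: a predicate winning against the crude demand range
`⌊(r−2)/hd⌋ + 1 ≤ r₁` (p647518) wins against the layer-cake range, because `⌊(r−2)/hd⌋ + 1 ≤ ⌈S(hd,r)/hd⌉` whenever
`2 ≤ r ≤ 2^hd` (the first layer-cake term alone is `r − 1`) — and when `r > 2^hd` there is no demand at all. -/
theorem boxWinning_layerCake_of_crude (W : (hd : ℕ) → (r : ℕ) → (Fin r → Fin m × (Fin D → Option (Fin N))) → Prop)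
    (hwin : ∀ (hd r : ℕ) (e : Fin r → Fin m × (Fin D → Option (Fin N))), W hd r e → 2 ≤ r → 1 ≤ hd →
      ∀ r₀ r₁ : ℕ, r₀ + r₁ = r → (r - 2) / hd + 1 ≤ r₁ → r₁ ≤ r₀ → r₀ ≤ 2 ^ (hd - 1) →
        ∃ (f : Fin m → Fin D) (side : Fin m → Option (Fin N) → Bool) (g₀ : Fin r₀ → Fin r) (g₁ : Fin r₁ → Fin r),
          Function.Injective (Sum.elim g₀ g₁) ∧
          (∀ j, side (e (g₀ j)).1 ((e (g₀ j)).2 (f (e (g₀ j)).1)) = false) ∧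
          (∀ j, side (e (g₁ j)).1 ((e (g₁ j)).2 (f (e (g₁ j)).1)) = true) ∧
          W (hd - 1) r₀ (fun j => e (g₀ j)) ∧ W (hd - 1) r₁ (fun j => e (g₁ j))) :
    (∀ (hd r : ℕ) (e : Fin r → Fin m × (Fin D → Option (Fin N))), W hd r e → 2 ≤ r → 1 ≤ hd →
      ∀ r₀ r₁ : ℕ, r₀ + r₁ = r →
            (∑ d ∈ Finset.range hd, (r - ∑ j ∈ Finset.range (d + 1), hd.choose j) + hd - 1) / hd ≤ r₁ → r₁ ≤ r₀ →
            r₀ ≤ 2 ^ (hd - 1) →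
            ∃ (f : Fin m → Fin D) (side : Fin m → Option (Fin N) → Bool) (g₀ : Fin r₀ → Fin r) (g₁ : Fin r₁ → Fin r),
              Function.Injective (Sum.elim g₀ g₁) ∧
              (∀ j, side (e (g₀ j)).1 ((e (g₀ j)).2 (f (e (g₀ j)).1)) = false) ∧
              (∀ j, side (e (g₁ j)).1 ((e (g₁ j)).2 (f (e (g₁ j)).1)) = true) ∧
              W (hd - 1) r₀ (fun j => e (g₀ j)) ∧ W (hd - 1) r₁ (fun j => e (g₁ j))) := by
  intro hd r e hW hr hhd r₀ r₁ hsum hlc h10 hpow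
  refine hwin hd r e hW hr hhd r₀ r₁ hsum ?_ h10 hpow
  -- crude ≤ sharp: the `d = 0` term of the layer cake is `r − C(hd,0) = r − 1`
  have hS : r - 1 ≤ ∑ d ∈ Finset.range hd, (r - ∑ j ∈ Finset.range (d + 1), hd.choose j) := by
    have h0 : 0 ∈ Finset.range hd := Finset.mem_range.mpr hhd
    calc r - 1 = r - ∑ j ∈ Finset.range (0 + 1), hd.choose j := by simp
      _ ≤ ∑ d ∈ Finset.range hd, (r - ∑ j ∈ Finset.range (d + 1), hd.choose j) :=
          Finset.single_le_sum (f := fun d => r - ∑ j ∈ Finset.range (d + 1), hd.choose j) (fun _ _ => Nat.zero_le _) h0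
  have h1 : (r - 2) / hd + 1 ≤ (r - 1 + hd - 1) / hd := by
    have : (r - 2) / hd + 1 = (r - 2 + hd) / hd := (Nat.add_div_right (r - 2) hhd).symm
    rw [this]
    exact Nat.div_le_div_right (by omega)
  exact h1.trans ((Nat.div_le_div_right (by omega)).trans hlc)

/-- **THE BOX GAME WITH THE SHARP FLOOR CERTIFIES.** As `simplexSymGood_of_boxWinning` (p647518), with the demand floor
`⌈S(hd, r)/hd⌉` of the layer-cake link bound (p648639) in place of `⌊(r−2)/hd⌋ + 1`: every `W`-position is generically good (in the
encoded symbolic calculus) against EVERY injective lower row family on `≤ hd` coordinates. -/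
theorem simplexSymGood_of_boxWinning_layerCake (W : (hd : ℕ) → (r : ℕ) → (Fin r → Fin m × (Fin D → Option (Fin N))) → Prop)
    (hwin : ∀ (hd r : ℕ) (e : Fin r → Fin m × (Fin D → Option (Fin N))), W hd r e → 2 ≤ r → 1 ≤ hd →
      ∀ r₀ r₁ : ℕ, r₀ + r₁ = r →
        (∑ d ∈ Finset.range hd, (r - ∑ j ∈ Finset.range (d + 1), hd.choose j) + hd - 1) / hd ≤ r₁ → r₁ ≤ r₀ → r₀ ≤ 2 ^ (hd - 1) →
        ∃ (f : Fin m → Fin D) (side : Fin m → Option (Fin N) → Bool) (g₀ : Fin r₀ → Fin r) (g₁ : Fin r₁ → Fin r),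
          Function.Injective (Sum.elim g₀ g₁) ∧
          (∀ j, side (e (g₀ j)).1 ((e (g₀ j)).2 (f (e (g₀ j)).1)) = false) ∧
          (∀ j, side (e (g₁ j)).1 ((e (g₁ j)).2 (f (e (g₁ j)).1)) = true) ∧
          W (hd - 1) r₀ (fun j => e (g₀ j)) ∧ W (hd - 1) r₁ (fun j => e (g₁ j)))
    (hd r : ℕ) (u : Fin r → Finset (Fin h)) (C : Finset (Fin h)) (e : Fin r → Fin m × (Fin D → Option (Fin N)))
    (hC : C.card ≤ hd) (hu : Function.Injective u) (hlow : IsLowerSet (Set.range u)) (hsub : ∀ i, u i ⊆ C) (hW : W hd r e) :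
    SymbJoin.symDet u (fun k => enc (e k)) ≠ 0 := by
  classical
  -- the induced predicate on wide column data
  let W' : (hd : ℕ) → (r : ℕ) → (Fin r → Fin m × Finset (Fin (D * N))) → Prop :=
    fun hd r e' => ∃ e : Fin r → Fin m × (Fin D → Option (Fin N)), (e' = fun k => enc (e k)) ∧ W hd r e
  have hwin' : ∀ (hd r : ℕ) (e' : Fin r → Fin m × Finset (Fin (D * N))), W' hd r e' → 2 ≤ r → 1 ≤ hd →
      ∀ r₀ r₁ : ℕ, r₀ + r₁ = r → (∑ d ∈ Finset.range hd, (r - ∑ j ∈ Finset.range (d + 1), hd.choose j) + hd - 1) / hd ≤ r₁ → r₁ ≤ r₀ → r₀ ≤ 2 ^ (hd - 1) →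
        ∃ (β : Fin m → ℂ) (γ : Fin m → Fin (D * N) → ℂ) (g₀ : Fin r₀ → Fin r) (g₁ : Fin r₁ → Fin r),
          Function.Injective (Sum.elim g₀ g₁) ∧ (∀ j, SymbJoin.xi e' β γ (g₀ j) = 0) ∧ (∀ j, SymbJoin.xi e' β γ (g₁ j) ≠ 0) ∧
          W' (hd - 1) r₀ (fun j => e' (g₀ j)) ∧ W' (hd - 1) r₁ (fun j => e' (g₁ j)) := by
    rintro hd r e' ⟨e, rfl, hWe⟩ hr hhd r₀ r₁ hsum hlam h10 hpow
    obtain ⟨f, side, g₀, g₁, hg, hfalse, htrue, hW0, hW1⟩ := hwin hd r e hWe hr hhd r₀ r₁ hsum hlam h10 hpow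
    let ind : Bool → ℂ := fun b => if b then 1 else 0
    let β : Fin m → ℂ := fun p => ind (side p none)
    let γ : Fin m → Fin (D * N) → ℂ := fun p q =>
      if (finProdFinEquiv.symm q).1 = f p then ind (side p (some (finProdFinEquiv.symm q).2)) - ind (side p none) else 0
    have hxi : ∀ k, SymbJoin.xi (fun k => enc (e k)) β γ k = ind (side (e k).1 ((e k).2 (f (e k).1))) := by
      intro k
      refine xi_oneSlot e β γ k (f (e k).1) (side (e k).1) rfl (fun j => ?_) (fun f' j hf' => ?_)
      · dsimp only [γ]
        rw [Equiv.symm_apply_apply]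
        simp [ind]
      · dsimp only [γ]
        rw [Equiv.symm_apply_apply]
        simp [hf']
    refine ⟨β, γ, g₀, g₁, hg, fun j => ?_, fun j => ?_, ⟨fun j => e (g₀ j), rfl, hW0⟩, ⟨fun j => e (g₁ j), rfl, hW1⟩⟩
    · rw [hxi, hfalse j]; simp [ind]
    · rw [hxi, htrue j]; simp [ind]
  exact SymbJoin.symGood_of_winning W' (fun hd r => (∑ d ∈ Finset.range hd, (r - ∑ j ∈ Finset.range (d + 1), hd.choose j) + hd - 1) / hd)
    (fun hd r u C hCd hu _ hC hr => SymbJoin.exists_link_ge_layerCake hd u C hCd hu hC hr) hwin'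
    hd r u C (fun k => enc (e k)) hC hu hlow hsub ⟨e, rfl, hW⟩

/-- **A sharp-floor winning position is good for every lower row family** (`∃ table` form of the exact-support door). -/
theorem exists_simplexTable_of_boxWinning_layerCake
    (W : (hd : ℕ) → (r : ℕ) → (Fin r → Fin m × (Fin D → Option (Fin N))) → Prop) (hwin : ∀ (hd r : ℕ) (e : Fin r → Fin m × (Fin D → Option (Fin N))), W hd r e → 2 ≤ r → 1 ≤ hd →
      ∀ r₀ r₁ : ℕ, r₀ + r₁ = r →
        (∑ d ∈ Finset.range hd, (r - ∑ j ∈ Finset.range (d + 1), hd.choose j) + hd - 1) / hd ≤ r₁ → r₁ ≤ r₀ → r₀ ≤ 2 ^ (hd - 1) →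
        ∃ (f : Fin m → Fin D) (side : Fin m → Option (Fin N) → Bool) (g₀ : Fin r₀ → Fin r) (g₁ : Fin r₁ → Fin r),
          Function.Injective (Sum.elim g₀ g₁) ∧
          (∀ j, side (e (g₀ j)).1 ((e (g₀ j)).2 (f (e (g₀ j)).1)) = false) ∧
          (∀ j, side (e (g₁ j)).1 ((e (g₁ j)).2 (f (e (g₁ j)).1)) = true) ∧
          W (hd - 1) r₀ (fun j => e (g₀ j)) ∧ W (hd - 1) r₁ (fun j => e (g₁ j)))
    {r : ℕ} (e : Fin r → Fin m × (Fin D → Option (Fin N))) (hW : W h r e)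
    (u : Fin r → Finset (Fin h)) (hu : Function.Injective u) (hlow : IsLowerSet (Set.range u)) :
    ∃ tx : Fin m → Option (Fin D × Fin N) → Fin h → ℂ,
      (Matrix.of fun i k : Fin r => ∏ a ∈ u i,
        (tx (e k).1 none a + ∑ f : Fin D, ((e k).2 f).elim 0 fun j => tx (e k).1 (some (f, j)) a)).det ≠ 0 := by
  refine exists_simplexTable_of_symGood u e ?_
  refine simplexSymGood_of_boxWinning_layerCake W hwin h r u Finset.univ e ?_ hu hlow (fun i => Finset.subset_univ _) hW
  rw [Finset.card_univ, Fintype.card_fin]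

/-- **ONE SHARP-FLOOR WINNING ROOT DESIGN PER `(h, r)` GIVES THE REGISTERED PAIR NODE.** If some predicate `W` winning the box game
with the layer-cake floor admits, for all large `h` and every `r ≤ 2^h`, a budget-legal simplex-product design (`m ≤ (2h)²` pieces, depth
`D ≤ 2h`, width `N ≤ (2h)²`, exact live enumeration) that is a `W`-position with `h` coordinates, then `SimplexJoin.Stmt.simplexPairLower`. -/
theorem simplexPairLower_of_boxWinning_layerCake
    (HW : ∃ h₁ : ℕ, ∀ h : ℕ, h₁ ≤ h → ∀ r : ℕ, r ≤ 2 ^ h →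
      ∃ (m D N : ℕ) (S : Fin m → Fin D → Finset (Fin N)) (e : Fin r → Fin m × (Fin D → Option (Fin N)))
        (W : (hd : ℕ) → (r : ℕ) → (Fin r → Fin m × (Fin D → Option (Fin N))) → Prop),
        m ≤ (h + h) ^ 2 ∧ D ≤ h + h ∧ N ≤ (h + h) ^ 2 ∧ Function.Injective e ∧
        (∀ c : Fin m × (Fin D → Option (Fin N)),
          c ∈ Set.range e ↔ ∀ (f : Fin D) (j : Fin N), c.2 f = some j → j ∈ S c.1 f) ∧
        (∀ (hd r : ℕ) (e : Fin r → Fin m × (Fin D → Option (Fin N))), W hd r e → 2 ≤ r → 1 ≤ hd →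
          ∀ r₀ r₁ : ℕ, r₀ + r₁ = r →
            (∑ d ∈ Finset.range hd, (r - ∑ j ∈ Finset.range (d + 1), hd.choose j) + hd - 1) / hd ≤ r₁ → r₁ ≤ r₀ →
            r₀ ≤ 2 ^ (hd - 1) →
            ∃ (f : Fin m → Fin D) (side : Fin m → Option (Fin N) → Bool) (g₀ : Fin r₀ → Fin r) (g₁ : Fin r₁ → Fin r),
              Function.Injective (Sum.elim g₀ g₁) ∧
              (∀ j, side (e (g₀ j)).1 ((e (g₀ j)).2 (f (e (g₀ j)).1)) = false) ∧
              (∀ j, side (e (g₁ j)).1 ((e (g₁ j)).2 (f (e (g₁ j)).1)) = true) ∧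
              W (hd - 1) r₀ (fun j => e (g₀ j)) ∧ W (hd - 1) r₁ (fun j => e (g₁ j))) ∧
        W h r e) :
    Stmt.simplexPairLower := by
  obtain ⟨h₁, HW⟩ := HW
  refine ⟨h₁, fun h hh r u w hu hw hul hwl => ?_⟩
  have hr : r ≤ 2 ^ h := by
    have := Fintype.card_le_of_injective u hu
    rwa [Fintype.card_fin, Fintype.card_finset, Fintype.card_fin] at this
  obtain ⟨m, D, N, S, e, W, hm, hD, hN, he, hlive, hwin, hWe⟩ := HW h hh r hr
  exact ⟨m, D, N, S, e, hm, hD, hN, he, hlive,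
    exists_simplexTable_of_boxWinning_layerCake W hwin e hWe u hu hul,
    exists_simplexTable_of_boxWinning_layerCake W hwin e hWe w hw hwl⟩

/-- **…and hence the item** (`b = 14`, through `partitionMinorsHitByVP_of_simplexPairLower`, p610840). -/
theorem partitionMinorsHitByVP_of_boxWinning_layerCake
    (HW : ∃ h₁ : ℕ, ∀ h : ℕ, h₁ ≤ h → ∀ r : ℕ, r ≤ 2 ^ h →
      ∃ (m D N : ℕ) (S : Fin m → Fin D → Finset (Fin N)) (e : Fin r → Fin m × (Fin D → Option (Fin N)))
        (W : (hd : ℕ) → (r : ℕ) → (Fin r → Fin m × (Fin D → Option (Fin N))) → Prop),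
        m ≤ (h + h) ^ 2 ∧ D ≤ h + h ∧ N ≤ (h + h) ^ 2 ∧ Function.Injective e ∧
        (∀ c : Fin m × (Fin D → Option (Fin N)),
          c ∈ Set.range e ↔ ∀ (f : Fin D) (j : Fin N), c.2 f = some j → j ∈ S c.1 f) ∧
        (∀ (hd r : ℕ) (e : Fin r → Fin m × (Fin D → Option (Fin N))), W hd r e → 2 ≤ r → 1 ≤ hd →
          ∀ r₀ r₁ : ℕ, r₀ + r₁ = r →
            (∑ d ∈ Finset.range hd, (r - ∑ j ∈ Finset.range (d + 1), hd.choose j) + hd - 1) / hd ≤ r₁ → r₁ ≤ r₀ →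
            r₀ ≤ 2 ^ (hd - 1) →
            ∃ (f : Fin m → Fin D) (side : Fin m → Option (Fin N) → Bool) (g₀ : Fin r₀ → Fin r) (g₁ : Fin r₁ → Fin r),
              Function.Injective (Sum.elim g₀ g₁) ∧
              (∀ j, side (e (g₀ j)).1 ((e (g₀ j)).2 (f (e (g₀ j)).1)) = false) ∧
              (∀ j, side (e (g₁ j)).1 ((e (g₁ j)).2 (f (e (g₁ j)).1)) = true) ∧
              W (hd - 1) r₀ (fun j => e (g₀ j)) ∧ W (hd - 1) r₁ (fun j => e (g₁ j))) ∧
        W h r e) :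
    Summit.ValiantsHypothesis.ValiantsHypothesis.Theses.BarrierLever.PartitionMinorsHitByVP :=
  partitionMinorsHitByVP_of_simplexPairLower (simplexPairLower_of_boxWinning_layerCake HW)

end

end Summit.ValiantsHypothesis.ValiantsHypothesis.Theorems.BarrierLever.SimplexJoin.Cut
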